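import Summits.AtomisticToContinuum.BoseEinsteinCondensation.Theses.BECInsertionCorrector
import Summits.AtomisticToContinuum.BoseEinsteinCondensation.Theses.BECThomsonPrinciple
import Summits.AtomisticToContinuum.BoseEinsteinCondensation.Theorems.StaticResponseBound.Negative.Basic
import HarnessLib

/-!
# The static response bound implies the density response bound of route `BECThomsonPrinciple` — calibration

Helper (calibration) file for the crux `BECInsertionCorrector.StaticResponseBound`
(item stmt-AtomisticToContinuum-12057, line `stable-fraction-square-completion`, lead -2): the crux BY NAME
implies the open crux `BECThomsonPrinciple.DensityResponse` (item stmt-AtomisticToContinuum-9481) BY NAME —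
`densityResponse_of_staticResponseBound`.  The two cruxes are the same second-order response bound in two
dresses: 12057 fixes the box `L = (N/ρ)^{1/3}` at every `ρ < ρ₀` and every `N`, in the energy currency
`E₀ − Ct²N/max(ρa,|p|²) ≤ E_Ψ + t⟨∑cos⟩_Ψ` (all `t ∈ ℝ`); 9481 fixes `(N, L)` with `N ≤ ρ₀L³`, `N ≥ N₀`,
and asks `E₀ + s|⟨∑2cos⟩_Φ| ≤ E_Φ + Cs²N/(|p|∞² + (N/L³)a)` in `[0,∞]` (all `s ≥ 0`; its window hypothesis is
not needed).  Proof: put `ρ' := N/L³ ≤ ρ₀/2 < ρ₀`, so that `sideLength ρ' N = L` literally; the crux at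
`t = ±2s` gives `E₀ + 2s|⟨∑cos⟩| ≤ E_Φ + 4Cs²N/max(ρ'a, psq)`, and `|p|∞² + ρ'a ≤ psq + ρ'a ≤ 2max(ρ'a, psq)`
(`|p|∞ = 2π‖n‖_∞/L`, sup norm `≤` Euclidean norm), whence the constant `8C` and `N₀ = 1`.  So every team
and every refutation of 9481 bears on 12057: 12057 is at least as strong as 9481.  No new definitions.
-/

namespace Summit.AtomisticToContinuum.BoseEinsteinCondensation.Cruxes.StaticResponseBound.StableFractionSquareCompletion

open MeasureTheory
open scoped ENNReal
open Literature.MathematicalPhysics.QuantumManyBody.BoseGas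
open Summit.AtomisticToContinuum.BoseEinsteinCondensation.Theses
open Summit.AtomisticToContinuum.BoseEinsteinCondensation.Theorems.StaticResponseBound.Negative
  (psq cosMean Ineq Body psq_nonneg)

noncomputable section

/-- `sideLength (N/L³) N = L`: the box of side `L` has density `N/L³` (`N ≥ 1`, `L > 0`).
(Adapted from `Theorems/…SectorFloorToLandau.lean`.) [folklore] -/
theorem dr_sideLength_density {N : ℕ} (hN : 0 < N) {L : ℝ} (hL : 0 < L) :
    sideLength ((N : ℝ) / L ^ 3) N = L := by
  have hNr : (N : ℝ) ≠ 0 := Nat.cast_ne_zero.2 hN.ne'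
  rw [sideLength, div_div_eq_mul_div, mul_div_cancel_left₀ _ hNr, ← Real.rpow_natCast,
    ← Real.rpow_mul hL.le]
  norm_num

/-- The sup norm of the integer mode is at most its Euclidean norm: `(2π‖n‖_∞/L)² ≤ psq L n`. [folklore] -/
theorem dr_supNorm_sq_le_psq (L : ℝ) (n : Fin 3 → ℤ) :
    (2 * Real.pi * ‖(fun j => (n j : ℝ))‖ / L) ^ 2 ≤ psq L n := by
  have hsum0 : 0 ≤ ∑ i, (n i : ℝ) ^ 2 := Finset.sum_nonneg fun i _ => sq_nonneg _
  have hle : ‖(fun j => (n j : ℝ))‖ ≤ Real.sqrt (∑ i, (n i : ℝ) ^ 2) := by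
    refine (pi_norm_le_iff_of_nonneg (Real.sqrt_nonneg _)).2 fun i => ?_
    rw [Real.norm_eq_abs, ← Real.sqrt_sq_eq_abs]
    exact Real.sqrt_le_sqrt (Finset.single_le_sum (fun j _ => sq_nonneg ((n j : ℝ))) (Finset.mem_univ i))
  have h0 : 0 ≤ ‖(fun j => (n j : ℝ))‖ := norm_nonneg _
  unfold psq
  rw [show 2 * Real.pi * ‖(fun j => (n j : ℝ))‖ / L = 2 * Real.pi / L * ‖(fun j => (n j : ℝ))‖ by ring,
    mul_pow]
  refine mul_le_mul_of_nonneg_left ?_ (sq_nonneg _)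
  calc ‖(fun j => (n j : ℝ))‖ ^ 2 ≤ Real.sqrt (∑ i, (n i : ℝ) ^ 2) ^ 2 := pow_le_pow_left₀ h0 hle 2
    _ = ∑ i, (n i : ℝ) ^ 2 := Real.sq_sqrt hsum0

/-- The observable of stmt-9481 is twice the crux's: `∫(∑ᵢ 2cos(p·xᵢ))|Φ|² = 2⟨∑cos⟩_Φ`. [folklore] -/
theorem dr_integral_two_cos {N : ℕ} (L : ℝ) (n : Fin 3 → ℤ) (Φ : PeriodicTrialState N L) :
    ∫ X in cellN N L, (∑ i, 2 * Real.cos (2 * Real.pi / L * ∑ j, (n j : ℝ) * X i j)) * ‖Φ.ψ X‖ ^ 2 =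
      2 * cosMean L n Φ := by
  unfold cosMean
  rw [← integral_const_mul]
  refine integral_congr_ae (ae_of_all _ fun X => ?_)
  simp only [← Finset.mul_sum]
  ring

/-- Elementary: from `A − B(2s)² ≤ E + 2s X` and `A − B(2s)² ≤ E − 2s X` (`s ≥ 0`), `A + 2s|X| ≤ E + 4Bs²`.
[folklore] -/
theorem dr_abs_of_two_sided {A B E X s : ℝ}
    (h₁ : A - B * (2 * s) ^ 2 ≤ E + 2 * s * X) (h₂ : A - B * (-(2 * s)) ^ 2 ≤ E + -(2 * s) * X) :
    A + s * |2 * X| ≤ E + 4 * B * s ^ 2 := by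
  have e₁ : B * (2 * s) ^ 2 = 4 * B * s ^ 2 := by ring
  have e₂ : B * (-(2 * s)) ^ 2 = 4 * B * s ^ 2 := by ring
  rw [e₁] at h₁
  rw [e₂] at h₂
  rw [abs_mul, abs_of_pos (by norm_num : (0 : ℝ) < 2)]
  rcases le_or_gt 0 X with hX | hX
  · rw [abs_of_nonneg hX]; linarith
  · rw [abs_of_neg hX]; linarith

/-- **Calibration: `StaticResponseBound` (stmt-12057) ⟹ `DensityResponse` (stmt-9481), both BY NAME.**
With `(ρ₀, C)` from the crux, answer 9481 at every `M` with `ρ₀/2`, `8C`, `N₀ = 1`: for a box `(N, L)` with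
`N ≤ (ρ₀/2)L³` use the crux at the density `ρ' = N/L³` (box `sideLength ρ' N = L`) and `t = ±2s`.
[folklore] -/
theorem densityResponse_of_staticResponseBound :
    _root_.Summit.AtomisticToContinuum.BoseEinsteinCondensation.Theses.BECInsertionCorrector.StaticResponseBound →
    _root_.Summit.AtomisticToContinuum.BoseEinsteinCondensation.Theses.BECThomsonPrinciple.DensityResponse := by
  intro hS v hv M _hM
  obtain ⟨ρ₀, hρ₀, C, hC, hbody⟩ := hS v hv
  refine ⟨ρ₀ / 2, 8 * C, by positivity, by positivity, 1, ?_⟩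
  intro N hN L hL hNle n hn _hwin s hs Φ
  -- the density of the box and the identification `sideLength ρ' N = L`
  have hN0 : 0 < N := hN
  obtain ⟨ρ', hρ'⟩ : ∃ ρ' : ℝ, ρ' = (N : ℝ) / L ^ 3 := ⟨_, rfl⟩
  have hL3 : 0 < L ^ 3 := by positivity
  have hρ'pos : 0 < ρ' := by rw [hρ']; exact div_pos (Nat.cast_pos.2 hN0) hL3
  have hρ'le : ρ' ≤ ρ₀ / 2 := by rw [hρ', div_le_iff₀ hL3]; exact hNle
  have hρ'lt : ρ' < ρ₀ := by linarith
  have hside : sideLength ρ' N = L := by rw [hρ']; exact dr_sideLength_density hN0 hL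
  -- the crux at density `ρ'`, read in the box `L`
  have hcrux := hbody ρ' hρ'pos hρ'lt N
  rw [hside] at hcrux
  -- trivial if `Φ` has infinite energy
  rcases eq_or_ne (periodicEnergy v Φ) ⊤ with htop | hfin
  · rw [htop, top_add]; exact le_top
  have hE0fin : periodicGroundStateEnergy v N L ≠ ⊤ :=
    ne_top_of_le_ne_top hfin (periodicGroundStateEnergy_le v Φ)
  -- the two inequalities at `t = ±2s`, in `ℝ`
  have h₁ : (periodicGroundStateEnergy v N L).toReal -
      C * (2 * s) ^ 2 * N / max (ρ' * (scatteringLength v).toReal) (psq L n) ≤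
      (periodicEnergy v Φ).toReal + 2 * s * cosMean L n Φ := hcrux n hn (2 * s) Φ hfin
  have h₂ : (periodicGroundStateEnergy v N L).toReal -
      C * (-(2 * s)) ^ 2 * N / max (ρ' * (scatteringLength v).toReal) (psq L n) ≤
      (periodicEnergy v Φ).toReal + -(2 * s) * cosMean L n Φ := hcrux n hn (-(2 * s)) Φ hfin
  set B : ℝ := C * N / max (ρ' * (scatteringLength v).toReal) (psq L n) with hB
  have hn' : 0 < ‖(fun j => (n j : ℝ))‖ := by
    obtain ⟨i, hi⟩ : ∃ i, n i ≠ 0 := by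
      by_contra h0
      push Not at h0
      exact hn (funext h0)
    exact lt_of_lt_of_le (norm_pos_iff.2 (Int.cast_ne_zero.2 hi : ((n i : ℤ) : ℝ) ≠ 0))
      (norm_le_pi_norm (fun j => (n j : ℝ)) i)
  have hp0 : 0 < (2 * Real.pi * ‖(fun j => (n j : ℝ))‖ / L) ^ 2 := by positivity
  have hpsup := dr_supNorm_sq_le_psq L n
  have hmax0 : 0 < max (ρ' * (scatteringLength v).toReal) (psq L n) :=
    lt_max_of_lt_right (lt_of_lt_of_le hp0 hpsup)
  have hB1 : ∀ t : ℝ, C * t ^ 2 * N / max (ρ' * (scatteringLength v).toReal) (psq L n) = B * t ^ 2 := by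
    intro t; rw [hB]; ring
  rw [hB1] at h₁ h₂
  have hreal := dr_abs_of_two_sided h₁ h₂
  -- `4B ≤ 8C N/(|p|∞² + ρ'a)`
  have hρa0 : 0 ≤ N / L ^ 3 * (scatteringLength v).toReal := by positivity
  have hden0 : 0 < (2 * Real.pi * ‖(fun j => (n j : ℝ))‖ / L) ^ 2 + N / L ^ 3 * (scatteringLength v).toReal :=
    by linarith
  have hcoef : 4 * B * s ^ 2 ≤
      8 * C * s ^ 2 * N / ((2 * Real.pi * ‖(fun j => (n j : ℝ))‖ / L) ^ 2 + N / L ^ 3 * (scatteringLength v).toReal) := by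
    have hsum : (2 * Real.pi * ‖(fun j => (n j : ℝ))‖ / L) ^ 2 + N / L ^ 3 * (scatteringLength v).toReal ≤
        2 * max (ρ' * (scatteringLength v).toReal) (psq L n) := by
      rw [← hρ']
      have h2 := le_max_right (ρ' * (scatteringLength v).toReal) (psq L n)
      have h3 := le_max_left (ρ' * (scatteringLength v).toReal) (psq L n)
      linarith
    rw [hB, le_div_iff₀ hden0]
    have hCN : 0 ≤ C * N := by positivity
    calc 4 * (C * N / max (ρ' * (scatteringLength v).toReal) (psq L n)) * s ^ 2 *
          ((2 * Real.pi * ‖(fun j => (n j : ℝ))‖ / L) ^ 2 + N / L ^ 3 * (scatteringLength v).toReal)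
        ≤ 4 * (C * N / max (ρ' * (scatteringLength v).toReal) (psq L n)) * s ^ 2 *
          (2 * max (ρ' * (scatteringLength v).toReal) (psq L n)) :=
          mul_le_mul_of_nonneg_left hsum (by positivity)
      _ = 8 * C * s ^ 2 * N := by field_simp; ring
  -- assembly in `ℝ≥0∞`
  rw [dr_integral_two_cos]
  have hlhs : (periodicGroundStateEnergy v N L).toReal + s * |2 * cosMean L n Φ| ≤
      (periodicEnergy v Φ).toReal +
        8 * C * s ^ 2 * N / ((2 * Real.pi * ‖(fun j => (n j : ℝ))‖ / L) ^ 2 + N / L ^ 3 * (scatteringLength v).toReal) :=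
    hreal.trans (add_le_add le_rfl hcoef)
  have hs2 : 0 ≤ s * |2 * cosMean L n Φ| := mul_nonneg hs (abs_nonneg _)
  have hr : 0 ≤ 8 * C * s ^ 2 * N / ((2 * Real.pi * ‖(fun j => (n j : ℝ))‖ / L) ^ 2 + N / L ^ 3 * (scatteringLength v).toReal) :=
    div_nonneg (by positivity) hden0.le
  calc periodicGroundStateEnergy v N L + ENNReal.ofReal (s * |2 * cosMean L n Φ|)
      = ENNReal.ofReal ((periodicGroundStateEnergy v N L).toReal + s * |2 * cosMean L n Φ|) := by
        rw [ENNReal.ofReal_add ENNReal.toReal_nonneg hs2, ENNReal.ofReal_toReal hE0fin]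
    _ ≤ ENNReal.ofReal ((periodicEnergy v Φ).toReal +
        8 * C * s ^ 2 * N / ((2 * Real.pi * ‖(fun j => (n j : ℝ))‖ / L) ^ 2 + N / L ^ 3 * (scatteringLength v).toReal)) :=
        ENNReal.ofReal_le_ofReal hlhs
    _ = periodicEnergy v Φ + ENNReal.ofReal
        (8 * C * s ^ 2 * N / ((2 * Real.pi * ‖(fun j => (n j : ℝ))‖ / L) ^ 2 + N / L ^ 3 * (scatteringLength v).toReal)) := by
        rw [ENNReal.ofReal_add ENNReal.toReal_nonneg hr, ENNReal.ofReal_toReal hfin]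

end

end Summit.AtomisticToContinuum.BoseEinsteinCondensation.Cruxes.StaticResponseBound.StableFractionSquareCompletion
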